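import Summits.Langlands.Langlands.Theses.AbelianSurfaceSerre
import Literature.NumberTheory.GaloisRepresentations.InducedGaloisRep
import Literature.NumberTheory.GaloisRepresentations.LocalGaloisGroup
import Literature.NumberTheory.GaloisRepresentations.ModPGaloisRep
import Literature.NumberTheory.GaloisRepresentations.CrystallineOrdinaryShape

/-!
# Sketch — first lemmas of two crux ideas for `AbelianSurfaceSerre.QuadraticImprimitiveSurfaces`
(stmt-Langlands-17766; crux-ideate round 1, ideator 2).  Nothing here is proved; the defs only have
to elaborate.  They are the `First lemma:` fields of the cards

* `ellenberg-f9-anchor-real-quadratic`  → `EllenbergF9AnchorTotallyReal`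
* `klingen-cm-eisenstein-descent`        → `KlingenCMLifting`

plus the shared routine Clifford step `ImprimitiveIsInduced`.
-/

namespace Summit.Langlands.Langlands.Cruxes.QuadraticImprimitiveSurfaces.Sketch

open Literature.NumberTheory.GaloisRepresentations Literature.NumberTheory.Automorphic
open IsDedekindDomain NumberField Field

/-- Shared routine step (Clifford theory, provable now): in the crux, the hypothesis
"`r|_K` reducible for a quadratic `K`" makes `r` an induction from `K` at the level of
characteristic polynomials (hence of a.e. Frobenius data). -/
def ImprimitiveIsInduced : Prop :=
  ∀ (A : Literature.AlgebraicGeometry.Motives.AbelianVariety ℚ), A.dim = 2 →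
    (∀ f : A ⟶ A, ∃ n : ℤ, f = n • CategoryTheory.CategoryStruct.id A) →
    ∀ (p : ℕ) [Fact p.Prime] (b : Module.Basis (Fin 4) ℚ_[p] (A.rationalTateModule p))
      (r : FramedGaloisRep ℚ (PadicAlgCl p) 4),
      (∀ g : absoluteGaloisGroup ℚ, (r g).val =
        ((LinearMap.toMatrix b b (A.rationalTateRep p g⁻¹)).map
          (algebraMap ℚ_[p] (PadicAlgCl p))).transpose) →
      ∀ (K : Type) [Field K] [NumberField K] (hK : Module.finrank ℚ K = 2),
        ¬ FramedRep.IsIrreducible (r.restrictField K) →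
        ∃ s : FramedGaloisRep K (PadicAlgCl p) 2,
          FramedRep.IsIrreducible s ∧
            ∀ g : absoluteGaloisGroup ℚ, FramedRep.charpoly r g = FramedRep.charpoly (s.induce ℚ hK) g

/-- **Card `ellenberg-f9-anchor-real-quadratic`, first lemma (the lever, = Ellenberg 2005
Prop. 1.3 + Thm. 3.2 run over a totally real base `K` instead of `ℚ`, in LIFTING form: the
characteristic-`0` lift is given — in the crux it is `T_{λ₃}(A_K)^∨` — so Ramakrishna's `ℚ`-specific
lifting step of Ellenberg's proof is not needed).**  For a totally real number field `K` unramified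
at `3` and `5`, let `ρ̄ : Γ_K → GL₂(k)` (`k ⊇ 𝔽₉` algebraically closed of characteristic `3`, discrete)
be `𝔽₉`-valued, totally odd, absolutely irreducible, with determinant the mod-`3` cyclotomic
character (Tate-module normalisation), ordinary at every `w ∣ 3` with inertial diagonal `(χ̄₃, 1)`
and distinguished, and with inertia images of odd order at the places above `5` (Ellenberg's
hypotheses).  Then every `r : Γ_K → GL₂(ℚ̄₃)` which is Greenberg-ordinary of shape `(0,1)` and
residually distinguished at every `w ∣ 3`, unramified almost everywhere, and whose integral
characteristic polynomials reduce to those of `ρ̄^∨` (the `H¹`-normalisation of the crux), is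
automorphic of weight zero over `K` in the weak a.e. Satake form used by the crux. -/
def EllenbergF9AnchorTotallyReal : Prop :=
  ∀ (K : Type) [Field K] [NumberField K], IsTotallyReal K →
    ¬ ((3 : ℤ) ∣ NumberField.discr K) → ¬ ((5 : ℤ) ∣ NumberField.discr K) →
    ∀ (k : Type) [Field k] [CharP k 3] [IsAlgClosed k] [TopologicalSpace k] [DiscreteTopology k]
      (ρ : FramedGaloisRep K k 2),
      (∀ (g : absoluteGaloisGroup K) (i j : Fin 2), ((ρ g).val i j) ^ 9 = (ρ g).val i j) →
      ρ.IsOdd → FramedRep.IsAbsolutelyIrreducible ρ →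
      (∀ g : absoluteGaloisGroup K, ((FramedRep.det ρ g : kˣ) : k) =
        ZMod.castHom (dvd_refl 3) k ((modPCyclotomicCharacterZMod K 3 g : (ZMod 3)ˣ) : ZMod 3)) →
      (∀ w : HeightOneSpectrum (𝓞 K), ((3 : ℕ) : 𝓞 K) ∈ w.asIdeal →
        letI : NeZero ((3 : ℕ) : w.adicCompletion K) :=
          ⟨by
            haveI : CharZero (w.adicCompletion K) :=
              charZero_of_injective_algebraMap (algebraMap K (w.adicCompletion K)).injective
            exact Nat.cast_ne_zero.mpr (by norm_num)⟩
        ∃ g : GL (Fin 2) k,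
          (∀ τ : absoluteGaloisGroup (w.adicCompletion K), (g * ρ.toLocal w τ * g⁻¹).val 1 0 = 0) ∧
          (∀ τ ∈ absInertia (w.adicCompletion K),
            (g * ρ.toLocal w τ * g⁻¹).val 0 0 =
              ZMod.castHom (dvd_refl 3) k
                ((modPCyclotomicCharacterZMod (w.adicCompletion K) 3 τ : (ZMod 3)ˣ) : ZMod 3) ∧
            (g * ρ.toLocal w τ * g⁻¹).val 1 1 = 1) ∧
          ∃ τ : absoluteGaloisGroup (w.adicCompletion K),
            (g * ρ.toLocal w τ * g⁻¹).val 0 0 ≠ (g * ρ.toLocal w τ * g⁻¹).val 1 1) →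
      (∀ v : HeightOneSpectrum (𝓞 K), ((5 : ℕ) : 𝓞 K) ∈ v.asIdeal →
        Odd (Nat.card ((absInertia (v.adicCompletion K)).map (ρ.toLocal v).toMonoidHom))) →
      ∀ (r : FramedGaloisRep K (PadicAlgCl 3) 2),
        (∀ w : HeightOneSpectrum (𝓞 K), ((3 : ℕ) : 𝓞 K) ∈ w.asIdeal →
          r.IsGreenbergOrdinaryOfShapeAt w ![0, 1] ∧ r.IsResiduallyDistinguishedAt w ![0, 1]) →
        (∀ᶠ v : HeightOneSpectrum (𝓞 K) in Filter.cofinite, r.IsUnramifiedAt v) →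
        (∃ red : (Valued.v : Valuation (PadicAlgCl 3) NNReal).valuationSubring →+* k,
          ∀ g : absoluteGaloisGroup K,
            ∃ P : Polynomial (Valued.v : Valuation (PadicAlgCl 3) NNReal).valuationSubring,
              P.map (Valued.v : Valuation (PadicAlgCl 3) NNReal).valuationSubring.subtype =
                  FramedRep.charpoly r g ∧
                P.map red = FramedRep.charpoly (FramedRep.dual ρ) g) →
        ∃ (hcpt : isCompact_glFiniteIntegralLevel 2 K) (π : CuspidalAutomorphicRepData 2 K hcpt)
          (ι : PadicAlgCl 3 ≃+* ℂ),
          π.1.HasWeightZero ∧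
          ∀ᶠ v : HeightOneSpectrum (𝓞 K) in Filter.cofinite, ∃ a : Multiset ℂ,
            π.1.HasSatakeParamAt v a ∧ r.IsUnramifiedAt v ∧
              r.HasFrobCharpolyAt v (arithFrobPolyOfSatake ι v.residueCard 1 a)

/-- **Card `klingen-cm-eisenstein-descent`, first lemma (the lever as a lifting statement:
"ordinary Skinner–Wiles / Berger–Klosin for `GSp₄/ℚ` in Klingen–Eisenstein type with CM
constituents").**  For `p ∈ {3, 5}`, an imaginary quadratic field `F`, a character
`χ̄ : Γ_F → k×` whose induction `W = Ind_F^ℚ χ̄` is irreducible, and the twist character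
`ψ = ε̄_p · (det W)⁻¹`: every irreducible `ρ : Γ_ℚ → GL₄(ℚ̄_p)`, symplectic with multiplier
`ε_p⁻¹`, Greenberg-ordinary of shape `(0,0,1,1)` and residually `p`-distinguished at `p`,
unramified almost everywhere, whose a.e. Frobenius polynomials reduce to
`charpoly(W) · charpoly(W ⊗ ψ)` — the residual shape of `Res_{F/ℚ} E` for `E/F` with an
`F`-rational `p`-isogeny of kernel character `χ̄` — is automorphic (weak a.e. Satake form on
`GL₄/ℚ`, the crux's conclusion clause). -/
def KlingenCMLifting : Prop :=
  ∀ (p : ℕ) [Fact p.Prime], (p = 3 ∨ p = 5) →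
    ∀ (k : Type) [Field k] [CharP k p] [IsAlgClosed k] [TopologicalSpace k] [DiscreteTopology k]
      (red : (Valued.v : Valuation (PadicAlgCl p) NNReal).valuationSubring →+* k)
      (F : Type) [Field F] [NumberField F] (hF : Module.finrank ℚ F = 2), IsTotallyComplex F →
    ∀ (χ : FramedGaloisRep F k 1) (W' : FramedGaloisRep ℚ k 2),
      let W : FramedGaloisRep ℚ k 2 := χ.induce ℚ hF
      let εb : absoluteGaloisGroup ℚ → k := fun g =>
        ZMod.castHom (dvd_refl p) k ((modPCyclotomicCharacterZMod ℚ p g : (ZMod p)ˣ) : ZMod p)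
      FramedRep.IsIrreducible W →
      (∀ g : absoluteGaloisGroup ℚ, (W' g).val =
        (εb g * ((FramedRep.det W g : kˣ) : k)⁻¹) • (W g).val) →
      ∀ (hcpt : isCompact_glFiniteIntegralLevel 4 ℚ) (ι : PadicAlgCl p ≃+* ℂ)
        (ρ : FramedGaloisRep ℚ (PadicAlgCl p) 4),
        ρ.toGaloisRep.IsIrreducible →
        ρ.IsSymplecticWithMultiplierFun (fun g => algebraMap ℚ_[p] (PadicAlgCl p)
          ((((GaloisRep.cyclotomicCharacter ℚ p g)⁻¹ : ℤ_[p]ˣ) : ℤ_[p]) : ℚ_[p])) →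
        (∀ v : HeightOneSpectrum (𝓞 ℚ), ((p : ℕ) : 𝓞 ℚ) ∈ v.asIdeal →
          ρ.IsGreenbergOrdinaryOfShapeAt v ![0, 0, 1, 1] ∧ ρ.IsResiduallyDistinguishedAt v ![0, 0, 1, 1]) →
        (∀ᶠ v : HeightOneSpectrum (𝓞 ℚ) in Filter.cofinite,
          ρ.IsUnramifiedAt v ∧ W.IsUnramifiedAt v ∧ W'.IsUnramifiedAt v ∧
            ∃ (P : Polynomial (Valued.v : Valuation (PadicAlgCl p) NNReal).valuationSubring)
              (P₁ P₂ : Polynomial k),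
              ρ.HasFrobCharpolyAt v
                  (P.map (Valued.v : Valuation (PadicAlgCl p) NNReal).valuationSubring.subtype) ∧
                W.HasFrobCharpolyAt v P₁ ∧ W'.HasFrobCharpolyAt v P₂ ∧ P.map red = P₁ * P₂) →
        ∃ π : CuspidalAutomorphicRepData 4 ℚ hcpt, π.1.IsLAlgebraic ∧
          ∀ᶠ v : HeightOneSpectrum (𝓞 ℚ) in Filter.cofinite, ∃ a : Multiset ℂ,
            π.1.HasSatakeParamAt v a ∧ ρ.IsUnramifiedAt v ∧
              ρ.HasFrobCharpolyAt v (arithFrobPolyOfSatake ι v.residueCard 1 a)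

end Summit.Langlands.Langlands.Cruxes.QuadraticImprimitiveSurfaces.Sketch
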